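import Literature.Topology.FourManifolds.HCobordism
import Literature.Topology.FourManifolds.HomotopySpheresBP
import HarnessLib

/-!
# Towards `exists_commGroup_homotopySphereClass_isCyclic_seven_holds`: the assembly step

Sibling proof file of `HCobordism.lean` (named fact
`Literature.Topology.FourManifolds.exists_commGroup_homotopySphereClass_isCyclic_seven`: `Θ₇ = HomotopySphereClass 7`
carries a commutative group structure whose multiplication is the connected sum and which is
cyclic; Kervaire–Milnor, *Groups of homotopy spheres I*, Ann. of Math. 77 (1963)). The fact
packages a whole theory (provefact triage `XL`), decomposed along Kervaire–Milnor's own proof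
into three named facts of the tree,

* (A) `Literature.Topology.FourManifolds.exists_commGroup_homotopySphereClass` (`HomotopySpheres.lean`; Kervaire–Milnor
  Thm. 1.1 with Smale's h-cobordism theorem): `Θₙ`, `n ≠ 0, 4`, is a commutative group under
  the connected sum;
* (B) `Literature.Topology.FourManifolds.HomotopySphere.boundsParallelizable_seven` (`HomotopySpheresBP.lean`; Kervaire–Milnor
  §4: `Θₙ / bPₙ₊₁ ↪ Πₙ / p(Sⁿ)` and `Π₇ / p(S⁷) = 0`, table p. 512): every homotopy `7`-sphere
  bounds a parallelizable manifold, i.e. `bP₈ = Θ₇`;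
* (C) `Literature.Topology.FourManifolds.HomotopySphereClass.isCyclic_bP_four_mul` (`HomotopySpheresBP.lean`; Kervaire–Milnor
  Cor. 7.6): `bP₄ₘ`, `m > 1`, is a finite cyclic subgroup of `Θ₄ₘ₋₁`,

and this file proves the **assembly step** sorry-free:
`Literature.SPC4.exists_commGroup_homotopySphereClass_isCyclic_seven_of : (A) → (B) → (C) → target`.
This is how the paper itself organises the computation of `Θₙ`: "It follows that `Θₙ / bPₙ₊₁`
is isomorphic to a subgroup of `Πₙ / p(Sⁿ)` … Using Theorem 4.1, the proof of the main theorem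
(Theorem 1.2) … reduces now to proving that `bPₙ₊₁` is finite" (p. 512, with the table giving
`Π₇ / p(S⁷) = 0`), and "`bP₄ₘ` is finite cyclic" (Cor. 7.6, p. 530); Kosinski,
*Differential Manifolds* (1993), Ch. X §6, p. 218: "`0 → bP⁴ⁿ → θ⁴ⁿ⁻¹ → Coker J₄ₙ₋₁ → 0`, where
`bP⁴ⁿ` is cyclic … Since `Coker J₇ = 0`, we see `θ⁷ = ℤ₂₈`."

## Proof

Take the group structure of (A) for `n = 7`. By (C) with `m = 2` there is a cyclic subgroup `H` of
`Θ₇` with underlying set `bP 7`, which is all of `Θ₇` by (B)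
(`HomotopySphereClass.bP_seven_eq_univ`); hence `H = ⊤` and `Θ₇ ≅ ⊤` is cyclic
(`Subgroup.topEquiv`, `isCyclic_of_surjective`).

What remains for `…_holds` is to discharge (A), (B), (C) themselves (connected sums and the
h-cobordism theorem; the Pontryagin–Thom construction, `Π₇ ≅ ℤ/240` and `im J₇ = Π₇`; surgery
and the signature obstruction), none of which is in Mathlib or in the tree.
-/

noncomputable section

namespace Literature.Topology.FourManifolds

-- `linter.deprecated` off for the next declaration only: it names the named fact
-- `exists_commGroup_homotopySphereClass` (`HomotopySpheres.lean`), deprecated 2026-08-15 (verdict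
-- clean-up: its instance `n = 3` is the Poincaré conjecture, not Kervaire–Milnor's Thm. 1.1) in
-- favour of `exists_commGroup_homotopySphereClass_of_ne_three`
-- (`HomotopySpheresGroupLeaves.lean`), as a hypothesis, applied in dimensions `≥ 5` only;
-- REMOVE-WHEN this declaration is migrated to the corrected fact.
set_option linter.deprecated false in
/-- **Assembly of Kervaire–Milnor's computation of `Θ₇` (cyclicity).** If `Θₙ` (`n ≠ 0, 4`) is
a commutative group under the connected sum (`Literature.Topology.FourManifolds.exists_commGroup_homotopySphereClass`,
Kervaire–Milnor 1963, Thm. 1.1), every homotopy `7`-sphere bounds a parallelizable manifold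
(`Literature.Topology.FourManifolds.HomotopySphere.boundsParallelizable_seven`, §4: `Θ₇ = bP₈`) and `bP₄ₘ` (`m > 1`) is a
finite cyclic subgroup for every such group structure
(`Literature.Topology.FourManifolds.HomotopySphereClass.isCyclic_bP_four_mul`, Cor. 7.6), then `Θ₇ = HomotopySphereClass 7`
carries a commutative group structure compatible with `HomotopySphereClass.IsMul` which is
cyclic (`Literature.Topology.FourManifolds.exists_commGroup_homotopySphereClass_isCyclic_seven`). Kervaire–Milnor,
*Groups of homotopy spheres I* (1963), p. 512 (reduction of the structure of `Θₙ` to `bPₙ₊₁` and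
`Πₙ / p(Sⁿ)`, table) and Cor. 7.6; Kosinski (1993), Ch. X §6, p. 218. [cite: KervaireMilnorAnnals1963, §4 p. 512 (table) and Cor. 7.6] [cite: Kosinski1993, Ch. X §6, (6.6) and p. 218] -/
theorem exists_commGroup_homotopySphereClass_isCyclic_seven_of
    (hA : exists_commGroup_homotopySphereClass)
    (hB : HomotopySphere.boundsParallelizable_seven)
    (hC : HomotopySphereClass.isCyclic_bP_four_mul) :
    exists_commGroup_homotopySphereClass_isCyclic_seven := by
  -- (A): a commutative group structure on `Θ₇` whose multiplication is the connected sum.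
  obtain ⟨inst, hmul, -, -⟩ := hA 7 (by norm_num) (by norm_num)
  refine ⟨inst, hmul, ?_⟩
  -- (C) with `m = 2`, `n = 7`: `bP₈` is the carrier of a cyclic subgroup `H`.
  obtain ⟨H, hH, hcyc, -⟩ := hC 2 7 (by norm_num) (by norm_num) hmul
  -- (B): `bP₈ = Θ₇`, so `H = ⊤`.
  have htop : H = ⊤ := by
    rw [← SetLike.coe_set_eq, hH, HomotopySphereClass.bP_seven_eq_univ hB, Subgroup.coe_top]
  subst htop
  -- `Θ₇ ≅ ⊤` is cyclic.
  exact isCyclic_of_surjective (Subgroup.topEquiv : (⊤ : Subgroup (HomotopySphereClass 7)) ≃* _)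
    Subgroup.topEquiv.surjective

-- `linter.deprecated` off for the next declaration only: it names the named fact
-- `exists_commGroup_homotopySphereClass` (`HomotopySpheres.lean`), deprecated 2026-08-15 (verdict
-- clean-up: its instance `n = 3` is the Poincaré conjecture, not Kervaire–Milnor's Thm. 1.1) in
-- favour of `exists_commGroup_homotopySphereClass_of_ne_three`
-- (`HomotopySpheresGroupLeaves.lean`), as a hypothesis, applied in dimensions `≥ 5` only;
-- REMOVE-WHEN this declaration is migrated to the corrected fact.
set_option linter.deprecated false in
/-- **Assembly from the layer-2 ingredients.** The same conclusion from Kervaire–Milnor's four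
printed inputs: the group structure on `Θₙ` (Thm. 1.1, `Literature.Topology.FourManifolds.exists_commGroup_homotopySphereClass`),
"every homotopy sphere is s-parallelizable" (Thm. 3.1, `Literature.Topology.FourManifolds.HomotopySphere.isStablyParallelizable`),
"an s-parallelizable homotopy `7`-sphere bounds a parallelizable manifold" (§4: Lemmas 4.2, 4.5 and
`Π₇ / p(S⁷) = 0`, table p. 512; `Literature.Topology.FourManifolds.HomotopySphere.boundsParallelizable_of_isStablyParallelizable_seven`)
and "`bP₄ₘ`, `m > 1`, is finite cyclic" (Cor. 7.6, `Literature.Topology.FourManifolds.HomotopySphereClass.isCyclic_bP_four_mul`).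
[cite: KervaireMilnorAnnals1963, Thm. 1.1, Thm. 3.1, §4 (table p. 512) and Cor. 7.6] -/
theorem exists_commGroup_homotopySphereClass_isCyclic_seven_of'
    (hA : exists_commGroup_homotopySphereClass)
    (hBa : HomotopySphere.isStablyParallelizable)
    (hBb : HomotopySphere.boundsParallelizable_of_isStablyParallelizable_seven)
    (hC : HomotopySphereClass.isCyclic_bP_four_mul) :
    exists_commGroup_homotopySphereClass_isCyclic_seven :=
  exists_commGroup_homotopySphereClass_isCyclic_seven_of hA
    (HomotopySphere.boundsParallelizable_seven_of hBa hBb) hC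

end Literature.Topology.FourManifolds
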